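import Summits.QuantumFields.YangMills.Theorems.BalabanUVNodesN07CritTangentInClass
import Literature.MathematicalPhysics.QuantumFieldTheory.Balaban1983to89.Node00.WilsonActionFirstVariationCoDiv

/-!
# BalabanUVNodes ∕ N07 — THE TANGENT-CRITICALITY OF THE MINIMISER OF RECORD IN THE LETTERS OF [15] (2): `Σ_b Re Tr( U_bX_bU_b⋆ · (D^{η*}_U∂U)(b) ) = 0` for every kernel
# direction (module 35g; the sentence a Sect.-F discharger starts from)

Cell `pub-ymgap`, seat `pub-ymgap-dag-n07-e` generation 14 (R141 (C), DAG node N07 = [15]; MODULE 35g).  `--kind proof --supports stmt-QuantumFields-20541` (count-neutral).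
CONSUMED BY NAME: 35d `N07CritTangentInClass` (`hasDerivAt_wilsonAction4_expChart_of_isBackground`, `…_of_isCritOfRecord_of_mem_bgReg`), 35f `Node00.WilsonActionFirstVariationCoDiv`
(`hasDerivAt_wilsonAction4_expChart_covDivT`).

WHY.  35c–35e give the tangent form `d∕dt A(U·exp(tX))∣₀ = 0` on the kernel; 35f identifies that derivative with `−(1∕N)·Σ_b Re Tr(U_bX_bU_b⋆ · η(D^{η*}_U∂U)(b))`.  Uniqueness of the
derivative gives the E–L statement in the letters of [15] (2)'s second clause ∕ n01-b's `InUkClassB11` current: for the minimiser of record (or any curve-critical member of the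
class) and every kernel direction `X`, `Σ_b Re Tr(U_bX_bU_b⋆ · (D^{η*}_U∂U)(b)) = 0` — print's (141)∕(143) shape «⟨δA′, J⟩ = 0 for all δA′ in the tangent space», at NODE 00's objects.

v1.1 (append-only): §2 `…_of_isCritOnFibre_of_chart` — the multi-scale fibre modulo a submersive chart (35a).
HONEST FRAMING: count-neutral bookkeeping (uniqueness of a derivative); nothing of [15]'s estimates; multi-scale `genSet` NOT treated; stub 1 ∕ K0⁷ NOT closed; N07 NOT discharged
(5∕27); one finite T⁴ programme at fixed ε — NOT continuum ∕ ℝ⁴ ∕ OS ∕ mass gap ∕ Clay.  No `sorry`, no `def`.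
-/

noncomputable section

open scoped Matrix.Norms.L2Operator Topology
open Filter Function NormedSpace

namespace Summit.QuantumFields.YangMills.BalabanUVNodes.N07CritCurrentForm

open Literature.MathematicalPhysics.QuantumFieldTheory.Balaban1983to89
open Literature.MathematicalPhysics.QuantumFieldTheory.Balaban1983to89.T4Continuum (T4Family)
open Literature.MathematicalPhysics.QuantumFieldTheory.Balaban1983to89.B15DeterminingSets
open Literature.MathematicalPhysics.QuantumFieldTheory.Balaban1983to89.BlockAveragingEMLHaarAC (emlWeight)
open Literature.MathematicalPhysics.QuantumFieldTheory.Balaban1983to89.ExpMeanLog (deltaSU)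
open Literature.MathematicalPhysics.QuantumFieldTheory.Balaban1983to89.T4AdjointCovarianceUnitary (lieSU)
open Literature.MathematicalPhysics.QuantumFieldTheory.Balaban1983to89.B10Eq27TorusAxialLog (toUField unitsField)
open Literature.MathematicalPhysics.QuantumFieldTheory.Balaban1983to89.B10Eq68TorusRegularity (covDivT)
open Literature.MathematicalPhysics.QuantumFieldTheory.Balaban1983to89.Node00
open Summit.QuantumFields.YangMills.Theorems.BlockAvgCorrector (stokesConst)
open Summit.QuantumFields.YangMills.BalabanUVNodes.N07CritTangentInClass

variable {F : T4Family} {N : ℕ} [NeZero N]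

/-- **FROM `HasDerivAt … 0 0` TO THE CURRENT PAIRING**: if the derivative of (5) along the ray `U·exp(tX)` vanishes, then `Σ_b Re Tr(U_bX_bU_b⋆ · η(D^{η*}_U∂U)(b)) = 0` (35f's formula and
uniqueness of the derivative; `η ≠ 0`, `N ≥ 1`). [cite: Balaban1985Variational, (2),(5) p.278, (141) p.299; Balaban1985RegularSpaces, (1.1)–(1.2) p.76] -/
theorem sum_re_trace_covDivT_eq_zero_of_hasDerivAt_zero {P : Params} {j : ℕ} (U : GaugeField P j (SU N)) (X : PBond P j → lieSU (Fin N)) {η : ℝ} (hη : η ≠ 0)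
    (h : HasDerivAt (fun t : ℝ => wilsonAction4 (expChart U (t • X))) 0 0) :
    ∑ b : PBond P j, (Matrix.trace ((U b : Matrix (Fin N) (Fin N) ℂ) * (X b : Matrix (Fin N) (Fin N) ℂ) * star (U b : Matrix (Fin N) (Fin N) ℂ) *
      (η • covDivT η (unitsField (toUField U)) b.dir b.src))).re = 0 := by
  have h' := hasDerivAt_wilsonAction4_expChart_covDivT U X hη
  have heq := h.unique h'
  have hN : (0 : ℝ) < (Fintype.card (Fin N) : ℝ) := by
    rw [Fintype.card_fin]
    exact_mod_cast Nat.pos_of_ne_zero (NeZero.ne N)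
  have : (∑ b : PBond P j, (Matrix.trace ((U b : Matrix (Fin N) (Fin N) ℂ) * (X b : Matrix (Fin N) (Fin N) ℂ) * star (U b : Matrix (Fin N) (Fin N) ℂ) *
      (η • covDivT η (unitsField (toUField U)) b.dir b.src))).re) / (Fintype.card (Fin N) : ℝ) = 0 := by
    have := heq.symm
    rwa [neg_eq_zero] at this
  rcases (div_eq_zero_iff.1 this) with h0 | h0
  · exact h0
  · exact absurd h0 hN.ne'

/-- ★★★ **THE MINIMISER OF RECORD SATISFIES THE LATTICE YANG–MILLS EQUATION ON THE TANGENT SPACE, IN THE LETTERS OF [15] (2)**: at NODE 00's objects, `k ≤ m + K`, `ε₀ = e` below the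
four tree ceilings, for a background `U = U_k(V)` of the variational problem of record over [15] (2)'s class (`IsBackground (avOfRecord F N K) {InUkClassB11 … e} k V U`) and every kernel
direction `X` of the linearised `k`-fold averaging: `Σ_b Re Tr( U_bX_bU_b⋆ · η·(D^{η*}_U ∂U)(b) ) = 0` (`η ≠ 0`; with `η = η_k` these are exactly the letters of (2)'s second clause) — print's
«⟨δA′, J⟩ = 0 for all δA′: QδA′ = 0» (141) read at the objects of record. [cite: Balaban1985Variational, (2),(5) p.278, Thm 1 p.279, (141) p.299, p.300; Balaban1985RegularSpaces, (1.1)–(1.2) p.76] -/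
theorem sum_re_trace_covDivT_eq_zero_of_isBackground {K k : ℕ} (hk : k ≤ (F.P K).m + (F.P K).K) {e : ℝ} (he : 0 < e)
    (h3 : (143 * (((((F.P K).d + 4 : ℕ) : ℝ)) ^ 2 / 4) ^ 2) * e ≤ 1 / 3)
    (h2 : 2 * e ≤ 2 * deltaSU (Fin N) / ((((F.P K).d + 4) * (F.P K).L : ℕ) : ℝ) ^ 2)
    (hst : stokesConst (F.P K) * (2 * e) < emlWeight (F.P K) / 16) (hstδ : stokesConst (F.P K) * (2 * e) < deltaSU (Fin N))
    {V : GaugeField (F.P K) k (SU N)} {U : GaugeField (F.P K) 0 (SU N)}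
    (hU : IsBackground (avOfRecord F N K) {U | InUkClassB11 F N K k e U} k V U)
    {X : PBond (F.P K) 0 → lieSU (Fin N)}
    (hX : ∀ c : PBond (F.P K) k, HasDerivAt
      (fun t : ℝ => ((avgFamily (avOfRecord F N K) (expChart U (t • X)) k c : SU N) : Matrix (Fin N) (Fin N) ℂ)) 0 0)
    {η : ℝ} (hη : η ≠ 0) :
    ∑ b : PBond (F.P K) 0, (Matrix.trace ((U b : Matrix (Fin N) (Fin N) ℂ) * (X b : Matrix (Fin N) (Fin N) ℂ) * star (U b : Matrix (Fin N) (Fin N) ℂ) *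
      (η • covDivT η (unitsField (toUField U)) b.dir b.src))).re = 0 :=
  sum_re_trace_covDivT_eq_zero_of_hasDerivAt_zero U X hη (hasDerivAt_wilsonAction4_expChart_of_isBackground hk he h3 h2 hst hstδ hU hX)

/-- The same for every member of the class `bgReg` that is curve-critical on `𝔅_k(Ū^k U)` (`IsCritOfRecord`). [cite: Balaban1985Variational, (2),(5) p.278, (141) p.299, p.300] -/
theorem sum_re_trace_covDivT_eq_zero_of_isCritOfRecord {K k : ℕ} (hk : k ≤ (F.P K).m + (F.P K).K) {ε₀ : ℝ} (hε₀ : 0 < ε₀)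
    (h3 : (143 * (((((F.P K).d + 4 : ℕ) : ℝ)) ^ 2 / 4) ^ 2) * ε₀ ≤ 1 / 3)
    (h2 : 2 * ε₀ ≤ 2 * deltaSU (Fin N) / ((((F.P K).d + 4) * (F.P K).L : ℕ) : ℝ) ^ 2)
    (hst : stokesConst (F.P K) * (2 * ε₀) < emlWeight (F.P K) / 16) (hstδ : stokesConst (F.P K) * (2 * ε₀) < deltaSU (Fin N))
    {U : GaugeField (F.P K) 0 (SU N)} (hU : U ∈ bgReg F N K k ε₀) (hcrit : IsCritOfRecord F N K k (avgFamily (avOfRecord F N K) U k) U)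
    {X : PBond (F.P K) 0 → lieSU (Fin N)}
    (hX : ∀ c : PBond (F.P K) k, HasDerivAt
      (fun t : ℝ => ((avgFamily (avOfRecord F N K) (expChart U (t • X)) k c : SU N) : Matrix (Fin N) (Fin N) ℂ)) 0 0)
    {η : ℝ} (hη : η ≠ 0) :
    ∑ b : PBond (F.P K) 0, (Matrix.trace ((U b : Matrix (Fin N) (Fin N) ℂ) * (X b : Matrix (Fin N) (Fin N) ℂ) * star (U b : Matrix (Fin N) (Fin N) ℂ) *
      (η • covDivT η (unitsField (toUField U)) b.dir b.src))).re = 0 :=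
  sum_re_trace_covDivT_eq_zero_of_hasDerivAt_zero U X hη (hasDerivAt_wilsonAction4_expChart_of_isCritOfRecord_of_mem_bgReg hk hε₀ h3 h2 hst hstδ hU hcrit hX)

/-! ## §2 (v1.1)  The MULTI-SCALE fibre (V16∕V18 stub 1's `genSet`), MODULO a submersive chart of the constraint (35a's `IsFibreChartNear`) -/

/-- ★★ **CURVE-CRITICAL ON ANY FIBRE ⇒ THE CURRENT FORM ON THE KERNEL OF A SUBMERSIVE CHART** (35a + 35f): for every determining set `𝐁` (in particular stub 1's multi-scale `genSet s.Ω k`),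
datum `W`, configuration `U` critical on `𝔅(𝐁, W)` in the curve form, and every LOCAL submersive chart `Φ` of the constraint at `U` (`IsFibreChartNear` — e.g. print's linearizing
transformation (47) once typed at objects), every kernel direction `X` of `Φ′` satisfies `Σ_b Re Tr(U_bX_bU_b⋆ · η·(D^{η*}_U∂U)(b)) = 0` (`η ≠ 0`).  This is the shape a Sect.-F discharger of
stub 1 starts from; the chart is its input, not constructed here (HOME/LOCATED-MULTISCALE-FIBRE.md). [cite: Balaban1985Variational, (3),(5)–(6) p.278, Sect. C (47) p.285, Prop. 3 p.289, (82)–(83) p.290, (141) p.299, p.300; Balaban1985RegularSpaces, (1.1)–(1.2) p.76] -/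
theorem sum_re_trace_covDivT_eq_zero_of_isCritOnFibre_of_chart {K : ℕ} {𝔹 : DetSet (F.P K)} {W : MSField (F.P K) (SU N)} {U : GaugeField (F.P K) 0 (SU N)}
    {V : Type*} [NormedAddCommGroup V] [NormedSpace ℝ V] [FiniteDimensional ℝ V]
    {Φ : (PBond (F.P K) 0 → lieSU (Fin N)) → V} {Φ' : (PBond (F.P K) 0 → lieSU (Fin N)) →L[ℝ] V}
    (hΦ : IsFibreChartNear F N K 𝔹 W U Φ Φ') (hcrit : IsCritOnFibre F N K 𝔹 W U) {X : PBond (F.P K) 0 → lieSU (Fin N)} (hX : Φ' X = 0)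
    {η : ℝ} (hη : η ≠ 0) :
    ∑ b : PBond (F.P K) 0, (Matrix.trace ((U b : Matrix (Fin N) (Fin N) ℂ) * (X b : Matrix (Fin N) (Fin N) ℂ) * star (U b : Matrix (Fin N) (Fin N) ℂ) *
      (η • covDivT η (unitsField (toUField U)) b.dir b.src))).re = 0 :=
  sum_re_trace_covDivT_eq_zero_of_hasDerivAt_zero U X hη (hasDerivAt_wilsonAction4_expChart_of_isCritOnFibre_near hΦ hcrit hX)

end Summit.QuantumFields.YangMills.BalabanUVNodes.N07CritCurrentForm

end
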